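import Summits.CriticalPhenomena.PercolationContinuityZ3.Theorems.PercNearOneGluingNoHeavyQuantFarGate3ChartCCertK
import Summits.CriticalPhenomena.PercolationContinuityZ3.Theorems.PercNearOneGluingNoHeavyQuantFarGate3ChartCCertU
import HarnessLib

/-!
# QUANT lane R8, front "FAR beyond trees", layer one — THE DEGREE-THREE GATE AT THE OBSERVER, L-c: box-certificate kernel v4-IVc — the assembled chart-C polynomial evaluates to `condC`

builds on p205010 (kernel theorem, internal audit signed; external expert review pending)

Support file (`--supports stmt-CriticalPhenomena-4575`), seat `prim-quant-p1` (gen 32); memo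
`run/shared/lean/prim/quant/prim-quant-p1-g32/FOR-LEAD-GATE3-CHARTC.md`.  Mathlib-only + earlier files of the chart-C box-certificate kernel;
standard axioms; no sorries.  GENERATED by `work/chartc/gen_certes.py` (pattern of files XLIVc/XLIVd, one dimension up, no windows).

Real multipliers read off the data (`mval`, `wt`, `lamL`, `nuL`) and the key identity `eval_polyOf`: the integer tensor assembled by `ChartC.check`
evaluates at `(σ, u, 1 − r₁, 1 − r₂)` to `condC` of those multipliers (entrywise: `eval_monoMul4`, `eval_GCn`, `eval_contrib`, `condC_single`).
[this work].
-/

noncomputable section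

namespace Summit.CriticalPhenomena.PercolationContinuityZ3.Theorems

namespace Quant

namespace ChartC

open BoxPoly4 BoxCert


/-! ## Real multipliers defined by the data -/

/-- Value of the monomial `w₁^b w₂^c σ^a u^e`, `m = b + 2c + 4a + 8e`. -/
def mval (m : ℕ) (σ u w₁ w₂ : ℝ) : ℝ :=
  (if m % 2 = 1 then w₁ else 1) * ((if m % 4 / 2 = 1 then w₂ else 1) * ((if m % 8 / 4 = 1 then σ else 1) * (if m % 16 / 8 = 1 then u else 1)))

/-- Weight of entry `e` at `(σ, u, r₁, r₂)`. -/
def wt (e : Entry) (σ u r₁ r₂ : ℝ) : ℝ := (e.mu : ℝ) * mval e.mono σ u (1 - r₁) (1 - r₂)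

/-- The linear multipliers `lam i c` defined by a list of entries. -/
def lamL (L : List Entry) (σ u r₁ r₂ : ℝ) (i : Fin 5) (c : Fin 8) : ℝ :=
  (L.map fun e => if e.kind = i.val ∧ e.idx = c.val then wt e σ u r₁ r₂ else 0).sum

/-- The row multipliers `nu k` defined by a list of entries. -/
def nuL (L : List Entry) (σ u r₁ r₂ : ℝ) (k : Fin 6) : ℝ :=
  (L.map fun e => if e.kind = 5 ∧ e.idx = k.val then wt e σ u r₁ r₂ else 0).sum

/-- `GcoC` indexed by a natural number (0 outside `0..4`). -/
def GcoCN (σ u r₁ r₂ : ℝ) (kind : ℕ) (c : Fin 8) : ℝ :=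
  if kind = 0 then GcoC σ u r₁ r₂ 0 c else if kind = 1 then GcoC σ u r₁ r₂ 1 c else if kind = 2 then GcoC σ u r₁ r₂ 2 c
  else if kind = 3 then GcoC σ u r₁ r₂ 3 c else if kind = 4 then GcoC σ u r₁ r₂ 4 c else 0

/-- `HQR` indexed by a natural number (0 outside `0..5`). -/
def HQRN (σ u : ℝ) (k : ℕ) (c c' : Fin 8) : ℝ :=
  if k = 0 then HQR σ u 0 c c' else if k = 1 then HQR σ u 1 c c' else if k = 2 then HQR σ u 2 c c' else if k = 3 then HQR σ u 3 c c'
  else if k = 4 then HQR σ u 4 c c' else if k = 5 then HQR σ u 5 c c' else 0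

/-- Real contribution of one entry to `condC`. -/
def condE (e : Entry) (σ u r₁ r₂ : ℝ) (c c' : Fin 8) : ℝ :=
  if e.kind ≤ 4 then
    (if e.idx = c.val then wt e σ u r₁ r₂ * GcoCN σ u r₁ r₂ e.kind c' else 0) +
      (if e.idx = c'.val ∧ c ≠ c' then wt e σ u r₁ r₂ * GcoCN σ u r₁ r₂ e.kind c else 0)
  else if e.kind = 5 then wt e σ u r₁ r₂ * HQRN σ u e.idx c c'
  else 0

/-- Monomial values are non-negative on the box. [this work] -/
theorem mval_nonneg (m : ℕ) (σ u w₁ w₂ : ℝ) (hσ : 0 ≤ σ) (hu : 0 ≤ u) (h1 : 0 ≤ w₁) (h2 : 0 ≤ w₂) : 0 ≤ mval m σ u w₁ w₂ := by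
  unfold mval; split_ifs <;> positivity

/-- Monomial values are positive in the open box. [this work] -/
theorem mval_pos (m : ℕ) (σ u w₁ w₂ : ℝ) (hσ : 0 < σ) (hu : 0 < u) (h1 : 0 < w₁) (h2 : 0 < w₂) : 0 < mval m σ u w₁ w₂ := by
  unfold mval; split_ifs <;> positivity

/-- Entry weights are non-negative. [this work] -/
theorem wt_nonneg (e : Entry) (σ u r₁ r₂ : ℝ) (hσ : 0 ≤ σ) (hu : 0 ≤ u) (h1 : r₁ ≤ 1) (h2 : r₂ ≤ 1) : 0 ≤ wt e σ u r₁ r₂ := by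
  unfold wt
  have := mval_nonneg e.mono σ u (1 - r₁) (1 - r₂) hσ hu (by linarith) (by linarith)
  positivity

/-- The linear multipliers are non-negative. [this work] -/
theorem lamL_nonneg (L : List Entry) (σ u r₁ r₂ : ℝ) (hσ : 0 ≤ σ) (hu : 0 ≤ u) (h1 : r₁ ≤ 1) (h2 : r₂ ≤ 1) (i : Fin 5) (c : Fin 8) :
    0 ≤ lamL L σ u r₁ r₂ i c := by
  unfold lamL
  apply List.sum_nonneg
  intro x hx
  rw [List.mem_map] at hx
  obtain ⟨e, -, rfl⟩ := hx
  split_ifs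
  · exact wt_nonneg e σ u r₁ r₂ hσ hu h1 h2
  · exact le_rfl

/-- The Harris multipliers are non-negative. [this work] -/
theorem nuL_nonneg (L : List Entry) (σ u r₁ r₂ : ℝ) (hσ : 0 ≤ σ) (hu : 0 ≤ u) (h1 : r₁ ≤ 1) (h2 : r₂ ≤ 1) (k : Fin 6) :
    0 ≤ nuL L σ u r₁ r₂ k := by
  unfold nuL
  apply List.sum_nonneg
  intro x hx
  rw [List.mem_map] at hx
  obtain ⟨e, -, rfl⟩ := hx
  split_ifs
  · exact wt_nonneg e σ u r₁ r₂ hσ hu h1 h2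
  · exact le_rfl

/-! ## The key identity: the assembled integer tensor evaluates to `condC` -/

/-- Vanishing of the top x-slice is preserved by `map`. [this work] -/
theorem fitsX_map (q : P4 ℤ) (h : TopX q) : ∀ j k l : Fin 3, map (Int.castRingHom ℝ) q 2 j k l = 0 := by
  intro j k l; simp [BoxPoly4.map, h j k l]
/-- Vanishing of the top y-slice is preserved by `map`. [this work] -/
theorem fitsY_map (q : P4 ℤ) (h : TopY q) : ∀ i k l : Fin 3, map (Int.castRingHom ℝ) q i 2 k l = 0 := by
  intro i k l; simp [BoxPoly4.map, h i k l]
/-- Vanishing of the top z-slice is preserved by `map`. [this work] -/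
theorem fitsZ_map (q : P4 ℤ) (h : TopZ q) : ∀ i j l : Fin 3, map (Int.castRingHom ℝ) q i j 2 l = 0 := by
  intro i j l; simp [BoxPoly4.map, h i j l]
/-- `fitsW_map` (see the file docstring). [this work] -/
theorem fitsW_map (q : P4 ℤ) (h : TopW q) : ∀ i j k : Fin 3, map (Int.castRingHom ℝ) q i j k 2 = 0 := by
  intro i j k; simp [BoxPoly4.map, h i j k]

/-- `evalR_shiftX` (see the file docstring). [this work] -/
theorem evalR_shiftX (q : P4 ℤ) (h : TopX q) {σ u x y : ℝ} :
    eval (map (Int.castRingHom ℝ) (BoxPoly4.shiftX q)) σ u x y = σ * eval (map (Int.castRingHom ℝ) q) σ u x y := by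
  rw [map_shiftX, eval_shiftX _ (fitsX_map q h)]
/-- `evalR_shiftY` (see the file docstring). [this work] -/
theorem evalR_shiftY (q : P4 ℤ) (h : TopY q) {σ u x y : ℝ} :
    eval (map (Int.castRingHom ℝ) (BoxPoly4.shiftY q)) σ u x y = u * eval (map (Int.castRingHom ℝ) q) σ u x y := by
  rw [map_shiftY, eval_shiftY _ (fitsY_map q h)]
/-- `evalR_shiftZ` (see the file docstring). [this work] -/
theorem evalR_shiftZ (q : P4 ℤ) (h : TopZ q) {σ u x y : ℝ} :
    eval (map (Int.castRingHom ℝ) (BoxPoly4.shiftZ q)) σ u x y = x * eval (map (Int.castRingHom ℝ) q) σ u x y := by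
  rw [map_shiftZ, eval_shiftZ _ (fitsZ_map q h)]
/-- `evalR_shiftW` (see the file docstring). [this work] -/
theorem evalR_shiftW (q : P4 ℤ) (h : TopW q) {σ u x y : ℝ} :
    eval (map (Int.castRingHom ℝ) (BoxPoly4.shiftW q)) σ u x y = y * eval (map (Int.castRingHom ℝ) q) σ u x y := by
  rw [map_shiftW, eval_shiftW _ (fitsW_map q h)]

/-- `topW_shiftZ` (see the file docstring). [this work] -/
theorem topW_shiftZ (q : P4 ℤ) (h : TopW q) : TopW (BoxPoly4.shiftZ q) := by
  intro i j k; fin_cases k <;> simp [BoxPoly4.shiftZ, h i j]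
/-- `topX_shiftZ` (see the file docstring). [this work] -/
theorem topX_shiftZ (q : P4 ℤ) (h : TopX q) : TopX (BoxPoly4.shiftZ q) := by
  intro j k l; fin_cases k <;> simp [BoxPoly4.shiftZ, h j]
/-- `topY_shiftZ` (see the file docstring). [this work] -/
theorem topY_shiftZ (q : P4 ℤ) (h : TopY q) : TopY (BoxPoly4.shiftZ q) := by
  intro i k l; fin_cases k <;> simp [BoxPoly4.shiftZ, h i]
/-- `topX_shiftW` (see the file docstring). [this work] -/
theorem topX_shiftW (q : P4 ℤ) (h : TopX q) : TopX (BoxPoly4.shiftW q) := by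
  intro j k l; fin_cases l <;> simp [BoxPoly4.shiftW, h j k]
/-- `topY_shiftW` (see the file docstring). [this work] -/
theorem topY_shiftW (q : P4 ℤ) (h : TopY q) : TopY (BoxPoly4.shiftW q) := by
  intro i k l; fin_cases l <;> simp [BoxPoly4.shiftW, h i k]
/-- `topY_shiftX` (see the file docstring). [this work] -/
theorem topY_shiftX (q : P4 ℤ) (h : TopY q) : TopY (BoxPoly4.shiftX q) := by
  intro i k l; fin_cases i <;> simp [BoxPoly4.shiftX, h _ k l]

/-- `monoMul4` is multiplication by the monomial (given no overflow). -/
theorem eval_monoMul4 (m : ℕ) (q : P4 ℤ) (σ u x y : ℝ)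
    (hZ : m % 2 = 1 → TopZ q) (hW : m % 4 / 2 = 1 → TopW q) (hX : m % 8 / 4 = 1 → TopX q) (hY : m % 16 / 8 = 1 → TopY q) :
    eval (map (Int.castRingHom ℝ) (monoMul4 m q)) σ u x y = mval m σ u x y * eval (map (Int.castRingHom ℝ) q) σ u x y := by
  unfold monoMul4 mval
  by_cases hz : m % 2 = 1 <;> by_cases hw : m % 4 / 2 = 1 <;> by_cases hx : m % 8 / 4 = 1 <;> by_cases hy : m % 16 / 8 = 1 <;>
    simp only [hz, hw, hx, hy, if_true, if_false]
  · rw [evalR_shiftY _ (topY_shiftX _ (topY_shiftW _ (topY_shiftZ _ (hY hy)))), evalR_shiftX _ (topX_shiftW _ (topX_shiftZ _ (hX hx))), evalR_shiftW _ (topW_shiftZ _ (hW hw)), evalR_shiftZ _ (hZ hz)]; ring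
  · rw [evalR_shiftX _ (topX_shiftW _ (topX_shiftZ _ (hX hx))), evalR_shiftW _ (topW_shiftZ _ (hW hw)), evalR_shiftZ _ (hZ hz)]; ring
  · rw [evalR_shiftY _ (topY_shiftW _ (topY_shiftZ _ (hY hy))), evalR_shiftW _ (topW_shiftZ _ (hW hw)), evalR_shiftZ _ (hZ hz)]; ring
  · rw [evalR_shiftW _ (topW_shiftZ _ (hW hw)), evalR_shiftZ _ (hZ hz)]; ring
  · rw [evalR_shiftY _ (topY_shiftX _ (topY_shiftZ _ (hY hy))), evalR_shiftX _ (topX_shiftZ _ (hX hx)), evalR_shiftZ _ (hZ hz)]; ring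
  · rw [evalR_shiftX _ (topX_shiftZ _ (hX hx)), evalR_shiftZ _ (hZ hz)]; ring
  · rw [evalR_shiftY _ (topY_shiftZ _ (hY hy)), evalR_shiftZ _ (hZ hz)]; ring
  · rw [evalR_shiftZ _ (hZ hz)]; ring
  · rw [evalR_shiftY _ (topY_shiftX _ (topY_shiftW _ (hY hy))), evalR_shiftX _ (topX_shiftW _ (hX hx)), evalR_shiftW _ (hW hw)]; ring
  · rw [evalR_shiftX _ (topX_shiftW _ (hX hx)), evalR_shiftW _ (hW hw)]; ring
  · rw [evalR_shiftY _ (topY_shiftW _ (hY hy)), evalR_shiftW _ (hW hw)]; ring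
  · rw [evalR_shiftW _ (hW hw)]; ring
  · rw [evalR_shiftY _ (topY_shiftX _ (hY hy)), evalR_shiftX _ (hX hx)]; ring
  · rw [evalR_shiftX _ (hX hx)]; ring
  · rw [evalR_shiftY _ (hY hy)]; ring
  · ring

/-- Top `σ`-slice of the form tables by natural kind (forms `g_v/p`, `g_S`). -/
theorem GCn_topX (kind : ℕ) (h : kind = 0 ∨ kind = 3) (c : Fin 8) : TopX (GCn kind c) := by
  rcases h with rfl | rfl
  · exact (GC_topX c).1
  · exact (GC_topX c).2
/-- Top `u`-slice of the form tables by natural kind (forms `0..3`). -/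
theorem GCn_topY (kind : ℕ) (h : kind ≤ 3) (c : Fin 8) : TopY (GCn kind c) := by
  interval_cases kind
  · exact (GC_topY c).1
  · exact (GC_topY c).2.1
  · exact (GC_topY c).2.2.1
  · exact (GC_topY c).2.2.2
/-- Top `w₁`-slice of the form tables by natural kind. -/
theorem GCn_topZ (kind : ℕ) (c : Fin 8) : TopZ (GCn kind c) := by
  unfold GCn; split
  · exact GC_topZ 0 c
  · exact GC_topZ 1 c
  · exact GC_topZ 2 c
  · exact GC_topZ 3 c
  · exact GC_topZ 4 c
  · intro i j l; rfl
/-- Top `w₂`-slice of the form tables by natural kind. -/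
theorem GCn_topW (kind : ℕ) (c : Fin 8) : TopW (GCn kind c) := by
  unfold GCn; split
  · exact GC_topW 0 c
  · exact GC_topW 1 c
  · exact GC_topW 2 c
  · exact GC_topW 3 c
  · exact GC_topW 4 c
  · intro i j k; rfl

/-- Evaluation of the form tables by natural kind. -/
theorem eval_GCn (kind : ℕ) (hk : kind ≤ 4) (c : Fin 8) (σ u r₁ r₂ : ℝ) (hr : r₁ ≤ r₂) :
    eval (map (Int.castRingHom ℝ) (GCn kind c)) σ u (1 - r₁) (1 - r₂) = GcoCN σ u r₁ r₂ kind c := by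
  interval_cases kind
  · rw [show GCn 0 c = GC 0 c from rfl, eval_GC _ _ σ u r₁ r₂ hr]; simp [GcoCN]
  · rw [show GCn 1 c = GC 1 c from rfl, eval_GC _ _ σ u r₁ r₂ hr]; simp [GcoCN]
  · rw [show GCn 2 c = GC 2 c from rfl, eval_GC _ _ σ u r₁ r₂ hr]; simp [GcoCN]
  · rw [show GCn 3 c = GC 3 c from rfl, eval_GC _ _ σ u r₁ r₂ hr]; simp [GcoCN]
  · rw [show GCn 4 c = GC 4 c from rfl, eval_GC _ _ σ u r₁ r₂ hr]; simp [GcoCN]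

/-- Numeric consequences of `entryOk`. -/
theorem entry_facts (e : Entry) (he : entryOk e = true) :
    e.mono < 16 ∧ e.kind ≤ 5 ∧ (e.kind ≤ 4 → e.idx < 8) ∧ (e.kind = 5 → e.idx < 6) ∧
      (e.mono % 8 / 4 = 1 → e.kind = 0 ∨ e.kind = 3 ∨ (e.kind = 5 ∧ 3 ≤ e.idx)) ∧
      (e.mono % 16 / 8 = 1 → e.kind ≤ 3 ∨ (e.kind = 5 ∧ e.idx ≤ 4)) := by
  simp only [entryOk, okX, okY, Bool.and_eq_true, Bool.or_eq_true, decide_eq_true_eq] at he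
  obtain ⟨⟨⟨hmono, hkind⟩, hx⟩, hy⟩ := he
  refine ⟨hmono, ?_, ?_, ?_, ?_, ?_⟩
  · rcases hkind with h | h <;> omega
  · intro h4; rcases hkind with h | h
    · exact h.2
    · omega
  · intro h5; rcases hkind with h | h
    · omega
    · exact h.2
  · intro hb; rcases hx with h | h
    · omega
    · exact h
  · intro hb; rcases hy with h | h
    · omega
    · exact h

/-- Per-entry identity. -/
theorem eval_contrib (e : Entry) (he : entryOk e = true) (c c' : Fin 8) (σ u r₁ r₂ : ℝ) (hr : r₁ ≤ r₂) :
    eval (map (Int.castRingHom ℝ) (contrib e c c')) σ u (1 - r₁) (1 - r₂) = condE e σ u r₁ r₂ c c' := by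
  obtain ⟨hmono, hk5, hidx8, hidx6, hbx, hby⟩ := entry_facts e he
  unfold contrib condE
  by_cases hk4 : e.kind ≤ 4
  · rw [if_pos hk4, if_pos hk4]
    have hev : ∀ cc : Fin 8, eval (map (Int.castRingHom ℝ) (BoxPoly4.smul (e.mu : ℤ) (monoMul4 e.mono (GCn e.kind cc)))) σ u (1 - r₁) (1 - r₂) =
        wt e σ u r₁ r₂ * GcoCN σ u r₁ r₂ e.kind cc := by
      intro cc
      have hX : e.mono % 8 / 4 = 1 → TopX (GCn e.kind cc) := fun hb => GCn_topX e.kind (by rcases hbx hb with h | h | h <;> omega) cc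
      have hY : e.mono % 16 / 8 = 1 → TopY (GCn e.kind cc) := fun hb => GCn_topY e.kind (by rcases hby hb with h | h <;> omega) cc
      rw [BoxPoly4.map_smul, eval_smul, eval_monoMul4 _ _ _ _ _ _ (fun _ => GCn_topZ e.kind cc) (fun _ => GCn_topW e.kind cc) hX hY,
        eval_GCn e.kind hk4 cc σ u r₁ r₂ hr]
      simp only [eq_intCast, Int.cast_natCast, wt]
      ring
    rw [BoxPoly4.map_add, eval_add]
    congr 1
    · split_ifs with hc
      · exact hev c'
      · rw [BoxPoly4.map_zero, eval_zero]
    · split_ifs with hc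
      · exact hev c
      · rw [BoxPoly4.map_zero, eval_zero]
  · rw [if_neg hk4, if_neg hk4]
    by_cases h5 : e.kind = 5 ∧ e.idx < 6
    · have hX : e.mono % 8 / 4 = 1 → TopX (HQ ⟨e.idx, h5.2⟩ c c') := fun hb => HQ_topX _ c c' (by rcases hbx hb with h | h | h <;> simp <;> omega)
      have hY : e.mono % 16 / 8 = 1 → TopY (HQ ⟨e.idx, h5.2⟩ c c') := fun hb => HQ_topY _ c c' (by rcases hby hb with h | h <;> simp <;> omega)
      rw [dif_pos h5, if_pos h5.1, BoxPoly4.map_smul, eval_smul,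
        eval_monoMul4 _ _ _ _ _ _ (fun _ => HQ_topZ _ c c') (fun _ => HQ_topW _ c c') hX hY, eval_HQ]
      have hH : HQRN σ u e.idx c c' = HQR σ u ⟨e.idx, h5.2⟩ c c' := by
        obtain ⟨-, h6⟩ := h5
        unfold HQRN
        interval_cases hh : e.idx <;> simp
      rw [hH]
      simp only [eq_intCast, Int.cast_natCast, wt]
      ring
    · have hk5' : ¬ e.kind = 5 := fun h => h5 ⟨h, hidx6 h⟩
      rw [dif_neg h5, if_neg hk5', BoxPoly4.map_zero, eval_zero]

/-- Sum over the entries. -/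
theorem eval_fold (L : List Entry) (hL : ∀ e ∈ L, entryOk e = true) (c c' : Fin 8) (σ u r₁ r₂ : ℝ) (hr : r₁ ≤ r₂) :
    eval (map (Int.castRingHom ℝ) (L.foldr (fun e acc => BoxPoly4.add (contrib e c c') acc) BoxPoly4.zero)) σ u (1 - r₁) (1 - r₂) =
      (L.map fun e => condE e σ u r₁ r₂ c c').sum := by
  induction L with
  | nil => simp [BoxPoly4.map_zero, eval_zero]
  | cons e L ih =>
    rw [List.foldr_cons, BoxPoly4.map_add, eval_add, List.map_cons, List.sum_cons,
      eval_contrib e (hL e (by simp)) c c' σ u r₁ r₂ hr, ih (fun e' he' => hL e' (by simp [he']))]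

/-- Single-entry multipliers: `condC` of the weights of one entry is that entry's contribution. -/
theorem condC_single (e : Entry) (he : entryOk e = true) (σ u r₁ r₂ : ℝ) (c c' : Fin 8) :
    condC σ u r₁ r₂ (fun i x => if e.kind = i.val ∧ e.idx = x.val then wt e σ u r₁ r₂ else 0)
        (fun k => if e.kind = 5 ∧ e.idx = k.val then wt e σ u r₁ r₂ else 0) c c' = condE e σ u r₁ r₂ c c' := by
  obtain ⟨hmono, hk, hidx8, hidx6, -, -⟩ := entry_facts e he
  unfold condC condE GcoCN
  interval_cases hkv : e.kind
  · by_cases h1 : e.idx = c.val <;> by_cases h2 : e.idx = c'.val <;> by_cases h3 : c = c' <;> simp [h1, h2, h3, Fin.val_inj, @eq_comm _ c' c]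
  · by_cases h1 : e.idx = c.val <;> by_cases h2 : e.idx = c'.val <;> by_cases h3 : c = c' <;> simp [h1, h2, h3, Fin.val_inj, @eq_comm _ c' c]
  · by_cases h1 : e.idx = c.val <;> by_cases h2 : e.idx = c'.val <;> by_cases h3 : c = c' <;> simp [h1, h2, h3, Fin.val_inj, @eq_comm _ c' c]
  · by_cases h1 : e.idx = c.val <;> by_cases h2 : e.idx = c'.val <;> by_cases h3 : c = c' <;> simp [h1, h2, h3, Fin.val_inj, @eq_comm _ c' c]
  · by_cases h1 : e.idx = c.val <;> by_cases h2 : e.idx = c'.val <;> by_cases h3 : c = c' <;> simp [h1, h2, h3, Fin.val_inj, @eq_comm _ c' c]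
  · have h6 : e.idx < 6 := hidx6 rfl
    unfold HQRN
    interval_cases hiv : e.idx <;> simp

/-- Linearity bookkeeping: `condC (lamL, nuL) = Σ condE`. -/
theorem condC_lamL (L : List Entry) (hL : ∀ e ∈ L, entryOk e = true) (σ u r₁ r₂ : ℝ) (c c' : Fin 8) :
    condC σ u r₁ r₂ (lamL L σ u r₁ r₂) (nuL L σ u r₁ r₂) c c' = (L.map fun e => condE e σ u r₁ r₂ c c').sum := by
  induction L with
  | nil =>
    have e1 : lamL ([] : List Entry) σ u r₁ r₂ = fun _ _ => 0 := by funext i x; simp [lamL]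
    have e2 : nuL ([] : List Entry) σ u r₁ r₂ = fun _ => 0 := by funext k; simp [nuL]
    rw [e1, e2, condC_zero]; simp
  | cons e L ih =>
    have e1 : lamL (e :: L) σ u r₁ r₂ = fun i x => (if e.kind = i.val ∧ e.idx = x.val then wt e σ u r₁ r₂ else 0) + lamL L σ u r₁ r₂ i x := by
      funext i x; simp [lamL]
    have e2 : nuL (e :: L) σ u r₁ r₂ = fun k => (if e.kind = 5 ∧ e.idx = k.val then wt e σ u r₁ r₂ else 0) + nuL L σ u r₁ r₂ k := by
      funext k; simp [nuL]
    rw [e1, e2, condC_add, condC_single e (hL e (by simp)) σ u r₁ r₂ c c', ih (fun e' he' => hL e' (by simp [he'])), List.map_cons, List.sum_cons]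

/-- **Key identity.** -/
theorem eval_polyOf (d : Cert) (hL : ∀ e ∈ d.entries, entryOk e = true) (c c' : Fin 8) (σ u r₁ r₂ : ℝ) (hr : r₁ ≤ r₂) :
    eval (map (Int.castRingHom ℝ) (polyOf d c c')) σ u (1 - r₁) (1 - r₂) = condC σ u r₁ r₂ (lamL d.entries σ u r₁ r₂) (nuL d.entries σ u r₁ r₂) c c' := by
  rw [polyOf, eval_fold d.entries hL c c' σ u r₁ r₂ hr, condC_lamL d.entries hL]


end ChartC

end Quant

end Summit.CriticalPhenomena.PercolationContinuityZ3.Theorems
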